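import Literature.MathematicalPhysics.QuantumManyBody.PeriodicBoseGasEq243
import Literature.MathematicalPhysics.QuantumManyBody.PeriodicBoseGasEq225
import Literature.MathematicalPhysics.QuantumManyBody.PeriodicBoseGasBounded
import HarnessLib

/-!
# Fournais 2020, (2.43) on bounded states, from (2.25) and Lemma 2.4 on bounded states

Topic `Literature/MathematicalPhysics/QuantumManyBody` (provefacts
`Literature.MathematicalPhysics.QuantumManyBody.BoseGas.Fournais2020_lowerBound_Htilde` and
`…Fournais2020_condensation`, layer `Fournais2020_lemma24`). Second link of the bounded chain announced
in `PeriodicBoseGasBounded.lean` (`…Eq229Bdd → …Lemma24Bdd → …Eq243Bdd → …Thm21Bdd → …Eq317Bdd`):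

* `Fournais2020_eq243_bdd_of_eq225_lemma24_bdd : Fournais2020_eq225 → Fournais2020_lemma24_bdd →
  Fournais2020_eq243_bdd` — the `n`-particle bound [Fournais2020, (2.43)–(2.46)] on **bounded**
  symmetric states (`Fournais2020_eq243_bdd`) is the sum of (2.25) (Lemma 2.3, `Fournais2020_eq225`,
  discharged: `Fournais2020_eq225_holds`) and of Lemma 2.4 (2.26) on bounded states
  (`Fournais2020_lemma24_bdd`), by the assembly of `PeriodicBoseGasEq243.lean` run verbatim (the two
  inequalities concern the same state `Φ`; "combining the terms, remembering that the gap of the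
  kinetic energy was saved": `A₂` cancels, (2.44), `∫gω ≤ 8πa`, `C = C₁ + C₂ + 4π`);
* `Fournais2020_eq243_bdd_of_lemma24_bdd` — the same with (2.25) discharged.

No new definitions.

## References

* [Fournais2020] S. Fournais, *Length scales for BEC in the dilute Bose gas*, arXiv:2011.00309,
  EMS Ser. Congr. Rep. 18 (2021), doi:10.4171/ecr/18-1/7: (2.25), Lemma 2.4 (2.26), (2.43)–(2.46).
* [FournaisSolovej2020] S. Fournais, J. P. Solovej, *The energy of dilute Bose gases*,
  Ann. of Math. 192 (2020) 893–976: Lemma B.2.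
-/

noncomputable section

open MeasureTheory Filter
open scoped ENNReal NNReal Topology

namespace Literature.MathematicalPhysics.QuantumManyBody.BoseGas

/-- **Fournais 2020, (2.43) on bounded states, from (2.25) and Lemma 2.4 on bounded states.**
Verbatim the assembly `Fournais2020_eq243_of_eq225_lemma24` (`PeriodicBoseGasEq243.lean`): the
vendored (2.25) (Lemma 2.3) and Lemma 2.4 (2.26), the latter on bounded states, are added on the
same bounded state `Φ`; the pairing terms cancel, (2.44) combines the main terms, `∫gω ≤ 8πa`,
constant `C = C₁ + C₂ + 4π`, smallness of `R/ℓ` also giving `χ*χ ≥ ½` on `B̄(0,R/ℓ)` (finite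
attraction). [cite: Fournais2020, (2.43)–(2.46), (2.25), Lemma 2.4] -/
theorem Fournais2020_eq243_bdd_of_eq225_lemma24_bdd (h225 : Fournais2020_eq225)
    (h24 : Fournais2020_lemma24_bdd) : Fournais2020_eq243_bdd := by
  intro v hv hint ha ω hω χ hχ b s hb hs R hRpos hR
  obtain ⟨C₁, c₁, hC₁, hc₁, H25⟩ := h225 v hv hint ha ω hω χ hχ R hRpos hR
  obtain ⟨C₂, c₂, hC₂, hc₂, H26⟩ := h24 v hv hint ha ω hω χ hχ s hs R hRpos hR
  obtain ⟨D, hD, hDhalf⟩ := exists_selfConv_ge_half hχ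
  obtain ⟨Cχ, hCχ⟩ := hχ.hasCompactSupport.exists_bound_of_continuous hχ.contDiff.continuous
  have hsL : scatteringLength v ≠ ⊤ := by
    refine scatteringLength_ne_top ?_
    rw [lintegral_const_mul' _ _ (ENNReal.inv_ne_top.2 two_ne_zero)]
    exact ENNReal.mul_ne_top (ENNReal.inv_ne_top.2 two_ne_zero) hint
  have ha0 : 0 < (scatteringLength v).toReal := ENNReal.toReal_pos ha.ne' hsL
  refine ⟨C₁ + C₂ + 4 * Real.pi, min (min c₁ c₂) D, by positivity, by positivity, ?_⟩
  intro ℓ ρμ hℓ hρμ hRℓ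
  dsimp only
  intro n u Φ hΦm hΦb hΦs
  set a : ℝ := (scatteringLength v).toReal with hadef
  have hRℓ1 : R ≤ c₁ * ℓ := hRℓ.trans (by gcongr; exact (min_le_left _ _).trans (min_le_left _ _))
  have hRℓ2 : R ≤ c₂ * ℓ := hRℓ.trans (by gcongr; exact (min_le_left _ _).trans (min_le_right _ _))
  have hRD : R / ℓ ≤ D := by
    rw [div_le_iff₀ hℓ]
    exact hRℓ.trans (by gcongr; exact min_le_right _ _)
  -- the forms
  set nrm := ∫⁻ X in boxConfig n ℓ u, (‖Φ X‖₊ : ℝ≥0∞) ^ 2 with hnrm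
  set rep := ∫⁻ X in boxConfig n ℓ u, repBoxN v χ ℓ u X * (‖Φ X‖₊ : ℝ≥0∞) ^ 2 with hrep
  set attr := ∫⁻ X in boxConfig n ℓ u, attrBoxN v ω χ ℓ ρμ u X * (‖Φ X‖₊ : ℝ≥0∞) ^ 2 with hattr
  set kin := kinBoxN χ ℓ s b u Φ with hkin
  set Np := nPlusBoxN ℓ u Φ with hNp
  -- infinite forms: (2.43) is trivial
  by_cases hkt : kin = ⊤
  · rw [hkt]; simp only [top_add]; exact le_top
  by_cases hrt : rep = ⊤
  · rw [hrt]; simp only [add_top, top_add]; exact le_top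
  have hcoef : 0 < 4 * Real.pi * a * ρμ ^ 2 * ℓ ^ 3 +
      (C₁ + C₂ + 4 * Real.pi) * n * a / ℓ ^ 3 * (1 + a ^ 2 * (n + 1) ^ 2 / ℓ ^ 2 + (n + 1) * R ^ 2 / ℓ ^ 2) +
      (C₁ + C₂ + 4 * Real.pi) * a * ρμ := by positivity
  by_cases hnt : nrm = ⊤
  · have h0 : ENNReal.ofReal (4 * Real.pi * a * ρμ ^ 2 * ℓ ^ 3 +
        (C₁ + C₂ + 4 * Real.pi) * n * a / ℓ ^ 3 * (1 + a ^ 2 * (n + 1) ^ 2 / ℓ ^ 2 + (n + 1) * R ^ 2 / ℓ ^ 2) +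
        (C₁ + C₂ + 4 * Real.pi) * a * ρμ) ≠ 0 := by
      rw [Ne, ENNReal.ofReal_eq_zero, not_le]; exact hcoef
    calc _ ≤ (⊤ : ℝ≥0∞) := le_top
      _ = ENNReal.ofReal (4 * Real.pi * a * ρμ ^ 2 * ℓ ^ 3 +
            (C₁ + C₂ + 4 * Real.pi) * n * a / ℓ ^ 3 * (1 + a ^ 2 * (n + 1) ^ 2 / ℓ ^ 2 + (n + 1) * R ^ 2 / ℓ ^ 2) +
            (C₁ + C₂ + 4 * Real.pi) * a * ρμ) * nrm := by rw [hnt, ENNReal.mul_top h0]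
      _ ≤ _ := le_add_self
  -- finite forms
  have hNt : Np ≠ ⊤ := by
    have h1 : ENNReal.ofReal (b / ℓ ^ 2) * Np ≤ kin := nPlusBoxN_le_kinBoxN χ ℓ s b u Φ
    have h2 : ENNReal.ofReal (b / ℓ ^ 2) ≠ 0 := by
      rw [Ne, ENNReal.ofReal_eq_zero, not_le]; positivity
    intro htop
    rw [htop, ENNReal.mul_top h2, top_le_iff] at h1
    exact hkt h1
  have hAt : attr ≠ ⊤ := by
    refine ne_top_of_le_ne_top ?_ (lintegral_attrBoxN_le hω hsL hR hℓ hCχ hDhalf hRD ρμ u Φ)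
    refine ENNReal.mul_ne_top (ENNReal.mul_ne_top ENNReal.ofReal_ne_top ?_) hnt
    exact ENNReal.mul_ne_top (by finiteness) (ENNReal.mul_ne_top (ENNReal.mul_ne_top
      (ENNReal.mul_ne_top (by finiteness) (by finiteness)) (by finiteness))
      (ENNReal.mul_ne_top ENNReal.ofReal_ne_top hsL))
  -- (2.25) and (2.26)
  have h25 := H25 ℓ ρμ hℓ hρμ hRℓ1 n u Φ hΦm hΦs hnt hrt hAt hNt
  have h26 := H26 b ℓ hb hℓ hRℓ2 n u Φ hΦm hΦb hΦs hnt hrt hkt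
  -- pass to real numbers
  have hIgt : gOmegaIntegral v ω ≠ ⊤ :=
    ne_top_of_le_ne_top (ENNReal.mul_ne_top ENNReal.ofReal_ne_top hsL) (gOmegaIntegral_le hω)
  have hIg : (gOmegaIntegral v ω).toReal ≤ 8 * Real.pi * a := by
    have h := ENNReal.toReal_mono (ENNReal.mul_ne_top ENNReal.ofReal_ne_top hsL) (gOmegaIntegral_le hω)
    rwa [ENNReal.toReal_mul, ENNReal.toReal_ofReal (by positivity)] at h
  have key := eq243_real ENNReal.toReal_nonneg ENNReal.toReal_nonneg ha0.le hρμ.le hℓ hC₁.le hC₂.le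
    hIg h25 h26
  -- and back
  have hSq : 0 ≤ 2 * Real.pi * (a / ℓ ^ 3) * (ρμ * ℓ ^ 3 - n) ^ 2 := by positivity
  have hg : 0 ≤ b / ℓ ^ 2 := by positivity
  have hCg : 0 ≤ (C₁ + C₂ + 4 * Real.pi) * a * ((n + 1) / ℓ ^ 3 + ρμ) := by positivity
  rw [← ENNReal.toReal_le_toReal (by finiteness) (by finiteness)]
  rw [ENNReal.toReal_add (by finiteness) (by finiteness), ENNReal.toReal_add hAt (by finiteness),
    ENNReal.toReal_add (by finiteness) (by finiteness), ENNReal.toReal_add (by finiteness) (by finiteness),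
    ENNReal.toReal_add hkt hrt]
  simp only [ENNReal.toReal_mul, ENNReal.toReal_ofReal hSq, ENNReal.toReal_ofReal hg,
    ENNReal.toReal_ofReal hCg, ENNReal.toReal_ofReal hcoef.le]
  exact key


/-- **(2.43) on bounded states from Lemma 2.4 on bounded states** ((2.25) being discharged:
`Fournais2020_eq225_holds`). [cite: Fournais2020, (2.43)–(2.46), (2.25), Lemma 2.4] -/
theorem Fournais2020_eq243_bdd_of_lemma24_bdd (h24 : Fournais2020_lemma24_bdd) : Fournais2020_eq243_bdd :=
  Fournais2020_eq243_bdd_of_eq225_lemma24_bdd Fournais2020_eq225_holds h24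

end Literature.MathematicalPhysics.QuantumManyBody.BoseGas

end
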